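import Summits.QuantumFields.YangMills.Theorems.RationalShortRootRigidityLinearFactorObstruction
import Summits.QuantumFields.YangMills.Theorems.RationalShortRootRigiditySemiInvariant
import HarnessLib

/-!
# `RationalShortRootRigidity` — Step 1 assembly helper (§5 of the `stub_reduce` plan): honest invariance of the reduced pair

Helper lemmas INSIDE the paper proof of crux `stmt-QuantumFields-23124` (`F4SubCurvatureDoor.RationalShortRootRigidity`,
LINE g15-A of planner ym-idea-3; owner's assembly plan HOME l15/STUB-PLAN-Reduce.md §5):

**Lemma** (`invariance_of_reduced`).  Let `N = N₀ H`, `D = D₀ H ≠ 0` with `(N₀, D₀)` relatively prime, `D₀` of full degree in `p₀`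
and `N₀/D₀` axis-Stieltjes.  If `N` and `D` are `W(B₄)`-invariant and invariant under the short-root reflection
`s(p) = p − (Σp)/2·(1,1,1,1)`, then so are `N₀` and `D₀`.

Proof.  For each reflection generator `g` (sign flips, transpositions, `s`) the substitution `G = bind₁ L_g` is an involutive algebra
endomorphism fixing `N` and `D`; `semiInvariantOfReducedPair` (p665990) gives `G D₀ = ±D₀`, `G N₀ = ±N₀` with the same sign; the minus
sign makes `D₀` vanish on the mirror of `g`, so the mirror's linear form divides `D₀` (`hyperplaneVanishingDivides`, p665739),
contradicting `linearFactorObstruction` (p669672) — or, for constant `D₀`, `D₀ = −D₀ ≠ 0`.  Sign flips and transpositions generate all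
signed permutations (`Equiv.Perm.swap_induction_on` + induction over the flipped coordinates).

Mathlib + tree helpers only; THEOREMS ONLY; no named facts; no `sorry`; default heartbeats.  Nothing about the crux 23124, the route's
rung or the Yang–Mills mass gap is proved here.  Free-hands seat `ym-line-frs-p2` g10, `--supports stmt-QuantumFields-23124`.
-/

set_option autoImplicit false

namespace Summit.QuantumFields.YangMills.Theorems.RationalShortRootRigidity

open scoped BigOperators

/-- **Reflection-invariance transfer to the reduced pair** (generic generator step of STUB-PLAN-Reduce §5): a linear involution `g`
of `ℝ⁴`, realised by the substitution `L`, fixing the hyperplane `Σ aᵢ pᵢ = 0` pointwise and leaving `N`, `D` invariant, leaves the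
reduced pair `(N₀, D₀)` invariant. [folklore] -/
theorem reflection_invariance_transfer (L : Fin 4 → MvPolynomial (Fin 4) ℝ) (g : (Fin 4 → ℝ) → (Fin 4 → ℝ))
    (hL : ∀ (p : Fin 4 → ℝ) (i : Fin 4), MvPolynomial.eval p (L i) = g p i) (hinv : ∀ p, g (g p) = p)
    (a : Fin 4 → ℝ) (ha : a ≠ 0) (hfix : ∀ p : Fin 4 → ℝ, ∑ i, a i * p i = 0 → g p = p)
    (N D N₀ D₀ H : MvPolynomial (Fin 4) ℝ)
    (hN : ∀ p, MvPolynomial.eval (g p) N = MvPolynomial.eval p N)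
    (hD : ∀ p, MvPolynomial.eval (g p) D = MvPolynomial.eval p D)
    (hNfac : N = N₀ * H) (hDfac : D = D₀ * H) (hD0 : D ≠ 0) (hcop : IsRelPrime N₀ D₀)
    (hfull : MvPolynomial.coeff (Finsupp.single 0 D₀.totalDegree) D₀ ≠ 0)
    (hAS : ∀ q : Fin 3 → ℝ, q ≠ 0 → ∃ (k : ℕ) (ω r : Fin k → ℝ) (c : Polynomial ℝ),
        (∀ j, 0 < ω j) ∧ (∀ j, 0 ≤ r j) ∧
        ∀ t : ℝ, MvPolynomial.eval (Fin.cons t q) N₀ =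
          MvPolynomial.eval (Fin.cons t q) D₀ * (c.eval (t ^ 2) + ∑ j, r j / (t ^ 2 + ω j ^ 2))) :
    (∀ p, MvPolynomial.eval (g p) D₀ = MvPolynomial.eval p D₀) ∧
      (∀ p, MvPolynomial.eval (g p) N₀ = MvPolynomial.eval p N₀) := by
  classical
  have hGe : ∀ (F : MvPolynomial (Fin 4) ℝ) (p : Fin 4 → ℝ),
      MvPolynomial.eval p (MvPolynomial.bind₁ L F) = MvPolynomial.eval (g p) F := by
    intro F p
    rw [eval_bind₁_gen]
    have hpt : (fun i => MvPolynomial.eval p (L i)) = g p := funext (hL p)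
    rw [hpt]
  have hGG : ∀ F : MvPolynomial (Fin 4) ℝ, MvPolynomial.bind₁ L (MvPolynomial.bind₁ L F) = F := by
    intro F; apply MvPolynomial.funext; intro p; rw [hGe, hGe, hinv]
  have hGN : MvPolynomial.bind₁ L N = N := MvPolynomial.funext fun p => by rw [hGe, hN]
  have hGD : MvPolynomial.bind₁ L D = D := MvPolynomial.funext fun p => by rw [hGe, hD]
  rcases semiInvariantOfReducedPair (MvPolynomial.bind₁ L) N D N₀ D₀ H hGG hGN hGD hD0 hNfac hDfac hcop with
    ⟨hD₀, hN₀⟩ | ⟨hD₀, _⟩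
  · exact ⟨fun p => by rw [← hGe, hD₀], fun p => by rw [← hGe, hN₀]⟩
  · exfalso
    -- `D₀` vanishes on the mirror of `g`
    have hvan : ∀ p : Fin 4 → ℝ, ∑ i, a i * p i = 0 → MvPolynomial.eval p D₀ = 0 := by
      intro p hp
      have h1 : MvPolynomial.eval p (MvPolynomial.bind₁ L D₀) = MvPolynomial.eval p D₀ := by rw [hGe, hfix p hp]
      rw [hD₀, map_neg] at h1
      linarith
    rcases Nat.eq_zero_or_pos D₀.totalDegree with h0 | hpos
    · -- constant `D₀`: `G D₀ = D₀ = -D₀ ≠ 0`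
      have hC : D₀ = MvPolynomial.C (MvPolynomial.coeff 0 D₀) := MvPolynomial.totalDegree_eq_zero_iff_eq_C.1 h0
      have h1 : MvPolynomial.bind₁ L D₀ = D₀ := by rw [hC, MvPolynomial.bind₁_C_right]
      rw [h1] at hD₀
      have h2 : D₀ = 0 := by
        have h3 : D₀ + D₀ = 0 := by nth_rewrite 2 [hD₀]; exact add_neg_cancel D₀
        have h4 : (2 : ℝ) • D₀ = 0 := by rw [two_smul]; exact h3
        exact (smul_eq_zero.1 h4).resolve_left two_ne_zero
      exact hfull (by rw [h2, MvPolynomial.coeff_zero])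
    · exact linearFactorObstruction N₀ D₀ hcop hfull hpos hAS a ha (hyperplaneVanishingDivides 4 D₀ a ha hvan)

/-- `Σᵢ [i = a] pᵢ = p_a`. -/
theorem sum_ite_eq_mul (a : Fin 4) (p : Fin 4 → ℝ) : ∑ i, (if i = a then (1 : ℝ) else 0) * p i = p a := by
  rw [Finset.sum_eq_single a]
  · rw [if_pos rfl, one_mul]
  · intro i _ hi; rw [if_neg hi, zero_mul]
  · intro h; exact absurd (Finset.mem_univ a) h

/-- **Signed permutations from sign flips and transpositions**: invariance under the single sign flips and the transpositions
implies `W(B₄)`-invariance. [folklore] -/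
theorem isB4Inv_of_flip_swap (F : MvPolynomial (Fin 4) ℝ)
    (hflip : ∀ (a : Fin 4) (p : Fin 4 → ℝ),
      MvPolynomial.eval (fun i => if i = a then -p i else p i) F = MvPolynomial.eval p F)
    (hswap : ∀ (a b : Fin 4), a ≠ b → ∀ p : Fin 4 → ℝ,
      MvPolynomial.eval (fun i => p (Equiv.swap a b i)) F = MvPolynomial.eval p F) :
    ∀ (σ : Equiv.Perm (Fin 4)) (ε : Fin 4 → ℝ), (∀ i, ε i = 1 ∨ ε i = -1) →
      ∀ p : Fin 4 → ℝ, MvPolynomial.eval (fun i => ε i * p (σ i)) F = MvPolynomial.eval p F := by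
  classical
  -- permutations
  have hperm : ∀ (σ : Equiv.Perm (Fin 4)) (p : Fin 4 → ℝ),
      MvPolynomial.eval (fun i => p (σ i)) F = MvPolynomial.eval p F := by
    intro σ
    refine Equiv.Perm.swap_induction_on σ (fun p => rfl) ?_
    intro f x y hxy hf p
    have hpt : (fun i => p ((Equiv.swap x y * f) i)) = fun i => (fun j => p (Equiv.swap x y j)) (f i) := by
      funext i; rw [Equiv.Perm.mul_apply]
    rw [hpt]
    exact (hf (fun j => p (Equiv.swap x y j))).trans (hswap x y hxy p)
  -- signs, one coordinate at a time
  intro σ ε hε p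
  have hsigns : ∀ (q : Fin 4 → ℝ) (T : Finset (Fin 4)),
      MvPolynomial.eval (fun i => if i ∈ T then ε i * q i else q i) F = MvPolynomial.eval q F := by
    intro q T
    induction T using Finset.induction_on with
    | empty =>
      have hpt : (fun i => if i ∈ (∅ : Finset (Fin 4)) then ε i * q i else q i) = q := by
        funext i; rw [if_neg (Finset.notMem_empty i)]
      rw [hpt]
    | insert a T haT ih =>
      rcases hε a with h1 | h1
      · have hpt : (fun i => if i ∈ insert a T then ε i * q i else q i) =
            fun i => if i ∈ T then ε i * q i else q i := by
          funext i
          by_cases hi : i = a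
          · subst hi; rw [if_pos (Finset.mem_insert_self _ _), if_neg haT, h1, one_mul]
          · simp only [Finset.mem_insert, hi, false_or]
        rw [hpt, ih]
      · have hpt : (fun i => if i ∈ insert a T then ε i * q i else q i) =
            fun i => if i = a then -((fun j => if j ∈ T then ε j * q j else q j) i)
              else (fun j => if j ∈ T then ε j * q j else q j) i := by
          funext i
          by_cases hi : i = a
          · subst hi; simp only [Finset.mem_insert_self, if_true, haT, if_false, h1]; ring
          · simp only [Finset.mem_insert, hi, false_or, if_false]
        rw [hpt, hflip a, ih]
  have hpt : (fun i => ε i * p (σ i)) = fun i => if i ∈ (Finset.univ : Finset (Fin 4)) then ε i * (fun j => p (σ j)) i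
      else (fun j => p (σ j)) i := by
    funext i; rw [if_pos (Finset.mem_univ i)]
  rw [hpt, hsigns, hperm]

/-- **Honest invariance of the reduced pair** (STUB-PLAN-Reduce §5; `IsB4Inv`, `IsHalfInv`, `FullDeg`, `AxisStieltjes` unfolded as in the
crux text). [folklore] -/
theorem invariance_of_reduced (N D N₀ D₀ H : MvPolynomial (Fin 4) ℝ)
    (hBN : ∀ (σ : Equiv.Perm (Fin 4)) (ε : Fin 4 → ℝ), (∀ i, ε i = 1 ∨ ε i = -1) →
      ∀ p : Fin 4 → ℝ, MvPolynomial.eval (fun i => ε i * p (σ i)) N = MvPolynomial.eval p N)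
    (hBD : ∀ (σ : Equiv.Perm (Fin 4)) (ε : Fin 4 → ℝ), (∀ i, ε i = 1 ∨ ε i = -1) →
      ∀ p : Fin 4 → ℝ, MvPolynomial.eval (fun i => ε i * p (σ i)) D = MvPolynomial.eval p D)
    (hHN : ∀ p : Fin 4 → ℝ, MvPolynomial.eval (fun i => p i - (∑ j, p j) / 2) N = MvPolynomial.eval p N)
    (hHD : ∀ p : Fin 4 → ℝ, MvPolynomial.eval (fun i => p i - (∑ j, p j) / 2) D = MvPolynomial.eval p D)
    (hNfac : N = N₀ * H) (hDfac : D = D₀ * H) (hD0 : D ≠ 0) (hcop : IsRelPrime N₀ D₀)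
    (hfull : MvPolynomial.coeff (Finsupp.single 0 D₀.totalDegree) D₀ ≠ 0)
    (hAS : ∀ q : Fin 3 → ℝ, q ≠ 0 → ∃ (k : ℕ) (ω r : Fin k → ℝ) (c : Polynomial ℝ),
        (∀ j, 0 < ω j) ∧ (∀ j, 0 ≤ r j) ∧
        ∀ t : ℝ, MvPolynomial.eval (Fin.cons t q) N₀ =
          MvPolynomial.eval (Fin.cons t q) D₀ * (c.eval (t ^ 2) + ∑ j, r j / (t ^ 2 + ω j ^ 2))) :
    (∀ (σ : Equiv.Perm (Fin 4)) (ε : Fin 4 → ℝ), (∀ i, ε i = 1 ∨ ε i = -1) →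
      ∀ p : Fin 4 → ℝ, MvPolynomial.eval (fun i => ε i * p (σ i)) N₀ = MvPolynomial.eval p N₀) ∧
    (∀ (σ : Equiv.Perm (Fin 4)) (ε : Fin 4 → ℝ), (∀ i, ε i = 1 ∨ ε i = -1) →
      ∀ p : Fin 4 → ℝ, MvPolynomial.eval (fun i => ε i * p (σ i)) D₀ = MvPolynomial.eval p D₀) ∧
    (∀ p : Fin 4 → ℝ, MvPolynomial.eval (fun i => p i - (∑ j, p j) / 2) N₀ = MvPolynomial.eval p N₀) ∧
    (∀ p : Fin 4 → ℝ, MvPolynomial.eval (fun i => p i - (∑ j, p j) / 2) D₀ = MvPolynomial.eval p D₀) := by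
  classical
  -- (1) single sign flips
  have hflip : ∀ a : Fin 4,
      (∀ p : Fin 4 → ℝ, MvPolynomial.eval (fun i => if i = a then -p i else p i) D₀ = MvPolynomial.eval p D₀) ∧
      (∀ p : Fin 4 → ℝ, MvPolynomial.eval (fun i => if i = a then -p i else p i) N₀ = MvPolynomial.eval p N₀) := by
    intro a
    have hε : ∀ i : Fin 4, (fun i : Fin 4 => if i = a then (-1 : ℝ) else 1) i = 1 ∨
        (fun i : Fin 4 => if i = a then (-1 : ℝ) else 1) i = -1 := by
      intro i; by_cases hi : i = a
      · right; simp only [hi, if_true]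
      · left; simp only [hi, if_false]
    have hpt : ∀ p : Fin 4 → ℝ, (fun i => (fun i : Fin 4 => if i = a then (-1 : ℝ) else 1) i * p ((1 : Equiv.Perm (Fin 4)) i)) =
        fun i => if i = a then -p i else p i := by
      intro p; funext i; simp only [Equiv.Perm.one_apply]; split_ifs <;> ring
    refine reflection_invariance_transfer (fun i => if i = a then -MvPolynomial.X i else MvPolynomial.X i)
      (fun p i => if i = a then -p i else p i) ?_ ?_ (fun i => if i = a then 1 else 0) ?_ ?_ N D N₀ D₀ H ?_ ?_
      hNfac hDfac hD0 hcop hfull hAS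
    · intro p i
      show MvPolynomial.eval p (if i = a then -MvPolynomial.X i else MvPolynomial.X i) = if i = a then -p i else p i
      split_ifs <;> simp
    · intro p; funext i
      show (if i = a then -(if i = a then -p i else p i) else (if i = a then -p i else p i)) = p i
      by_cases hi : i = a <;> simp [hi]
    · intro h; have := congrFun h a; simp at this
    · intro p hp
      rw [sum_ite_eq_mul] at hp
      funext i
      show (if i = a then -p i else p i) = p i
      split_ifs with hi
      · rw [hi, hp, neg_zero]
      · rfl
    · intro p; rw [← hpt p]; exact hBN 1 _ hε p
    · intro p; rw [← hpt p]; exact hBD 1 _ hε p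
  -- (2) transpositions
  have hswap : ∀ a b : Fin 4, a ≠ b →
      (∀ p : Fin 4 → ℝ, MvPolynomial.eval (fun i => p (Equiv.swap a b i)) D₀ = MvPolynomial.eval p D₀) ∧
      (∀ p : Fin 4 → ℝ, MvPolynomial.eval (fun i => p (Equiv.swap a b i)) N₀ = MvPolynomial.eval p N₀) := by
    intro a b hab
    have hε : ∀ i : Fin 4, (fun _ : Fin 4 => (1 : ℝ)) i = 1 ∨ (fun _ : Fin 4 => (1 : ℝ)) i = -1 := fun i => Or.inl rfl
    have hpt : ∀ p : Fin 4 → ℝ, (fun i => (fun _ : Fin 4 => (1 : ℝ)) i * p ((Equiv.swap a b) i)) =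
        fun i => p (Equiv.swap a b i) := by
      intro p; funext i; simp only [one_mul]
    refine reflection_invariance_transfer (fun i => MvPolynomial.X (Equiv.swap a b i)) (fun p i => p (Equiv.swap a b i))
      ?_ ?_ (fun i => (if i = a then (1 : ℝ) else 0) - (if i = b then (1 : ℝ) else 0)) ?_ ?_ N D N₀ D₀ H ?_ ?_
      hNfac hDfac hD0 hcop hfull hAS
    · intro p i; simp only [MvPolynomial.eval_X]
    · intro p; funext i; simp only [Equiv.swap_apply_self]
    · intro h; have := congrFun h a; simp [hab] at this
    · intro p hp
      simp only [sub_mul, Finset.sum_sub_distrib, sum_ite_eq_mul] at hp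
      have hab' : p a = p b := by linarith
      funext i
      show p (Equiv.swap a b i) = p i
      rw [Equiv.swap_apply_def]
      split_ifs with h1 h2
      · rw [h1, hab']
      · rw [h2, hab']
      · rfl
    · intro p; rw [← hpt p]; exact hBN (Equiv.swap a b) _ hε p
    · intro p; rw [← hpt p]; exact hBD (Equiv.swap a b) _ hε p
  -- (3) the short-root reflection
  have hhalf :
      (∀ p : Fin 4 → ℝ, MvPolynomial.eval (fun i => p i - (∑ j, p j) / 2) D₀ = MvPolynomial.eval p D₀) ∧
      (∀ p : Fin 4 → ℝ, MvPolynomial.eval (fun i => p i - (∑ j, p j) / 2) N₀ = MvPolynomial.eval p N₀) := by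
    refine reflection_invariance_transfer (fun i => MvPolynomial.X i - MvPolynomial.C (1 / 2 : ℝ) * ∑ j, MvPolynomial.X j)
      (fun p i => p i - (∑ j, p j) / 2) ?_ ?_ (fun _ => (1 : ℝ)) ?_ ?_ N D N₀ D₀ H hHN hHD hNfac hDfac hD0 hcop hfull hAS
    · intro p i; simp only [map_sub, map_mul, MvPolynomial.eval_X, MvPolynomial.eval_C, map_sum]; ring
    · intro p; funext i; simp only [Finset.sum_sub_distrib, Finset.sum_const, Finset.card_univ, Fintype.card_fin]
      ring
    · intro h; have := congrFun h 0; simp at this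
    · intro p hp
      simp only [one_mul] at hp
      funext i; simp only [hp, zero_div, sub_zero]
  exact ⟨isB4Inv_of_flip_swap N₀ (fun a => (hflip a).2) (fun a b hab => (hswap a b hab).2),
    isB4Inv_of_flip_swap D₀ (fun a => (hflip a).1) (fun a b hab => (hswap a b hab).1), hhalf.2, hhalf.1⟩

end Summit.QuantumFields.YangMills.Theorems.RationalShortRootRigidity
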